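import Mathlib.RingTheory.MvPolynomial.Homogeneous
import Mathlib.RingTheory.GradedAlgebra.Homogeneous.Ideal
import HarnessLib

/-!
# Homogeneous prime avoidance in all large degrees

Let `R[x_t : t ∈ σ]` be a polynomial ring with its standard grading
(`MvPolynomial.homogeneousSubmodule σ R`) and let `P₁, …, P_s` be finitely many *relevant*
homogeneous prime ideals (homogeneous primes not containing all the variables, i.e. points of
`Proj R[x]`). The classical graded prime avoidance lemma (Bruns–Herzog, *Cohen–Macaulay rings*,
Lemma 1.5.10; Görtz–Wedhorn I, Prop. B.2 (2), used in Prop. 13.49) produces a homogeneous element of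
*some* positive degree outside `P₁ ∪ ⋯ ∪ P_s`. This file proves the sharper statement needed for
Noether normalisation of projective schemes over arbitrary (e.g. finite) fields by forms of
prescribed degree:

* `MvPolynomial.exists_forall_le_isHomogeneous_forall_notMem` — **there is `e₀` such that for every
  `e ≥ e₀` some form `F` of degree exactly `e` lies in no `P_j`**;
* `MvPolynomial.exists_forall_le_isHomogeneous_mem_forall_notMem` — the same with `F` inside a given
  homogeneous ideal `I ⊄ P_j` (Bruns–Herzog 1.5.10 as used in Kawasaki 2000, Lemma 5.3).

Proof (induction on `s`): remove a prime `P` minimal among the `P_j`; by induction there are forms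
`F'` of every large degree avoiding the others; there are a variable `ℓ ∉ P` (relevance) and a form
`y ∈ ⋂_{Q ≠ P} Q ∖ P` (homogeneous generators of the `Q ⊄ P`, multiplied together and by `ℓ`); then
`F'` or `F' + ℓ^{e - deg y} y` avoids all the primes. Over an infinite field and in degree `1` this is
the usual "general linear form"; the point here is that no hypothesis on `R` is needed.

## References

* W. Bruns, J. Herzog, *Cohen–Macaulay rings*, rev. ed., Cambridge Studies in Advanced Mathematics
  39 (1998), Lemma 1.5.10 (graded prime avoidance). [BrunsHerzog1998]
* U. Görtz, T. Wedhorn, *Algebraic Geometry I: Schemes*, 2nd ed. (2020), Prop. 13.49 and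
  Prop. B.2 (2) (prime avoidance for homogeneous ideals). [GortzWedhorn2020]
-/

noncomputable section

open MvPolynomial

namespace Literature.RingTheory.GradedAlgebra

attribute [local instance] MvPolynomial.gradedAlgebra

variable {σ : Type*} {R : Type*} [CommRing R]

/-- A homogeneous ideal of `R[x]` not contained in the ideal `P` has a *homogeneous* element outside
`P` (a homogeneous ideal is generated by its homogeneous elements). [folklore] -/
theorem MvPolynomial.exists_isHomogeneous_mem_notMem {Q P : Ideal (MvPolynomial σ R)}
    (hQ : Q.IsHomogeneous (homogeneousSubmodule σ R)) (hQP : ¬ Q ≤ P) :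
    ∃ (a : MvPolynomial σ R) (i : ℕ), a.IsHomogeneous i ∧ a ∈ Q ∧ a ∉ P := by
  by_contra h
  push Not at h
  apply hQP
  rw [← hQ.toIdeal_homogeneousCore_eq_self]
  change Ideal.span _ ≤ P
  rw [Ideal.span_le]
  rintro _ ⟨⟨a, i, hai⟩, haQ, rfl⟩
  exact h a i ((mem_homogeneousSubmodule i a).1 hai) haQ

/-- A homogeneous prime of `R[x]` not containing the irrelevant ideal misses some variable.
[folklore] -/
theorem MvPolynomial.exists_X_notMem_of_not_irrelevant_le {P : Ideal (MvPolynomial σ R)}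
    (hP : ¬ (HomogeneousIdeal.irrelevant (homogeneousSubmodule σ R)).toIdeal ≤ P) :
    ∃ t : σ, (X t : MvPolynomial σ R) ∉ P := by
  classical
  by_contra h
  push Not at h
  apply hP
  intro p hp
  rw [← DirectSum.sum_support_decompose (homogeneousSubmodule σ R) p]
  refine Ideal.sum_mem _ fun c hc => ?_
  by_cases hc0 : c = 0
  · subst hc0
    have : (DirectSum.decompose (homogeneousSubmodule σ R) p 0 : MvPolynomial σ R) = 0 := by
      simpa using hp
    rw [this]
    exact Ideal.zero_mem _
  · -- a form of positive degree lies in the ideal of the variables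
    have hmem : (DirectSum.decompose (homogeneousSubmodule σ R) p c : MvPolynomial σ R) ∈
        Ideal.span (Set.range (X : σ → MvPolynomial σ R)) ^ c := by
      rw [Ideal.mem_span_pow_iff_exists_isHomogeneous]
      refine ⟨MvPolynomial.map C (DirectSum.decompose (homogeneousSubmodule σ R) p c),
        ((DirectSum.decompose (homogeneousSubmodule σ R) p c).2).map _, ?_⟩
      rw [MvPolynomial.eval_map, MvPolynomial.eval₂_eta]
    have hle : Ideal.span (Set.range (X : σ → MvPolynomial σ R)) ≤ P :=
      Ideal.span_le.2 (by rintro _ ⟨t, rfl⟩; exact h t)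
    exact hle (Ideal.pow_le_self hc0 hmem)

/-- **Homogeneous prime avoidance in all large degrees.** For finitely many relevant homogeneous
prime ideals `P ∈ T` of `R[x_t : t ∈ σ]` (standard grading) there is `e₀` such that for every
`e ≥ e₀` some homogeneous polynomial of degree `e` lies outside every `P ∈ T` (refining graded
prime avoidance, Bruns–Herzog Lemma 1.5.10 / Görtz–Wedhorn I Prop. B.2 (2), which gives one such
degree). [folklore] -/
theorem MvPolynomial.exists_forall_le_isHomogeneous_forall_notMem
    (T : Finset (Ideal (MvPolynomial σ R))) (hprime : ∀ P ∈ T, P.IsPrime)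
    (hhom : ∀ P ∈ T, P.IsHomogeneous (homogeneousSubmodule σ R))
    (hrel : ∀ P ∈ T, ¬ (HomogeneousIdeal.irrelevant (homogeneousSubmodule σ R)).toIdeal ≤ P) :
    ∃ e₀ : ℕ, ∀ e, e₀ ≤ e → ∃ F : MvPolynomial σ R, F.IsHomogeneous e ∧ ∀ P ∈ T, F ∉ P := by
  classical
  -- induction on the number of primes
  induction hT : T.card generalizing T with
  | zero =>
    rw [Finset.card_eq_zero] at hT
    subst hT
    exact ⟨0, fun e _ => ⟨0, isHomogeneous_zero σ R e, fun P hP => (Finset.notMem_empty P hP).elim⟩⟩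
  | succ n ih =>
    -- a minimal prime `P ∈ T`
    have hne : T.Nonempty := Finset.card_pos.1 (by omega)
    obtain ⟨P, hPT, hPmin⟩ := Finset.exists_minimal hne
    have hcard : (T.erase P).card = n := by rw [Finset.card_erase_of_mem hPT, hT]; rfl
    obtain ⟨e₁, he₁⟩ := ih (T.erase P) (fun Q hQ => hprime Q (Finset.mem_of_mem_erase hQ))
      (fun Q hQ => hhom Q (Finset.mem_of_mem_erase hQ))
      (fun Q hQ => hrel Q (Finset.mem_of_mem_erase hQ)) hcard
    haveI : P.IsPrime := hprime P hPT
    -- a variable `ℓ ∉ P`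
    obtain ⟨t, ht⟩ := MvPolynomial.exists_X_notMem_of_not_irrelevant_le (hrel P hPT)
    -- homogeneous `a Q ∈ Q ∖ P` for `Q ∈ T ∖ {P}` (possible as `P` is minimal)
    have hex : ∀ Q ∈ T.erase P, ∃ (a : MvPolynomial σ R) (i : ℕ),
        a.IsHomogeneous i ∧ a ∈ Q ∧ a ∉ P := by
      intro Q hQ
      obtain ⟨hQP, hQT⟩ := Finset.mem_erase.1 hQ
      refine MvPolynomial.exists_isHomogeneous_mem_notMem (hhom Q hQT) fun hle => hQP ?_
      exact le_antisymm hle (hPmin hQT hle)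
    choose! a deg ha haQ haP using hex
    -- `y = ℓ · ∏ a Q`, homogeneous of degree `δ = 1 + Σ deg Q`, in every `Q ≠ P`, not in `P`
    set y : MvPolynomial σ R := X t * ∏ Q ∈ T.erase P, a Q with hy
    set δ : ℕ := 1 + ∑ Q ∈ T.erase P, deg Q with hδ
    have hyhom : y.IsHomogeneous δ :=
      (isHomogeneous_X R t).mul (IsHomogeneous.prod (T.erase P) a deg fun Q hQ => ha Q hQ)
    have hyQ : ∀ Q ∈ T.erase P, y ∈ Q := fun Q hQ => by
      obtain ⟨c, hc⟩ := Finset.dvd_prod_of_mem a hQ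
      rw [hy, hc]
      exact Ideal.mul_mem_left _ _ (Ideal.mul_mem_right _ _ (haQ Q hQ))
    have hyP : y ∉ P := by
      intro hyP'
      rcases (hprime P hPT).mem_or_mem hyP' with h | h
      · exact ht h
      · obtain ⟨Q, hQ, hQP⟩ := Ideal.IsPrime.prod_mem_iff.1 h
        exact haP Q hQ hQP
    -- conclusion: for `e ≥ max e₁ δ`
    refine ⟨max e₁ δ, fun e he => ?_⟩
    obtain ⟨F', hF', hF'T⟩ := he₁ e ((le_max_left _ _).trans he)
    by_cases hFP : F' ∈ P
    · refine ⟨F' + X t ^ (e - δ) * y, ?_, ?_⟩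
      · have h2 : (X t ^ (e - δ) * y).IsHomogeneous e := by
          have := ((isHomogeneous_X R t).pow (e - δ)).mul hyhom
          rwa [one_mul, Nat.sub_add_cancel ((le_max_right _ _).trans he)] at this
        exact hF'.add h2
      · intro Q hQ
        by_cases hQP : Q = P
        · subst hQP
          intro hmem
          have : X t ^ (e - δ) * y ∈ Q := by
            have := Q.sub_mem hmem hFP
            rwa [add_sub_cancel_left] at this
          rcases (hprime Q hPT).mem_or_mem this with h | h
          · exact ht ((hprime Q hPT).mem_of_pow_mem _ h)
          · exact hyP h
        · have hQ' : Q ∈ T.erase P := Finset.mem_erase.2 ⟨hQP, hQ⟩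
          intro hmem
          haveI : Q.IsPrime := hprime Q hQ
          have : F' ∈ Q := by
            have := Q.sub_mem hmem (Ideal.mul_mem_left _ (X t ^ (e - δ)) (hyQ Q hQ'))
            rwa [add_sub_cancel_right] at this
          exact hF'T Q hQ' this
    · refine ⟨F', hF', fun Q hQ => ?_⟩
      by_cases hQP : Q = P
      · subst hQP; exact hFP
      · exact hF'T Q (Finset.mem_erase.2 ⟨hQP, hQ⟩)

/-- **Homogeneous prime avoidance inside a homogeneous ideal, in all large degrees.** For a
homogeneous ideal `I` of `R[x_t : t ∈ σ]` (standard grading) and finitely many relevant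
homogeneous primes `P ∈ T` none of which contains `I`, there is `e₀` such that for every `e ≥ e₀`
some form of degree `e` lies in `I` but in no `P ∈ T` (Bruns–Herzog, Lemma 1.5.10, the form
actually used in Kawasaki 2000, Lemma 5.3 — "an easy consequence of prime avoidance" — to pick
homogeneous parameters inside the annihilator ideals). Same induction as
`MvPolynomial.exists_forall_le_isHomogeneous_forall_notMem`, the correcting element `y` being taken
in `I` as well. [cite: BrunsHerzog1998, Lemma 1.5.10] -/
theorem MvPolynomial.exists_forall_le_isHomogeneous_mem_forall_notMem
    {I : Ideal (MvPolynomial σ R)} (hI : I.IsHomogeneous (homogeneousSubmodule σ R))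
    (T : Finset (Ideal (MvPolynomial σ R))) (hprime : ∀ P ∈ T, P.IsPrime)
    (hhom : ∀ P ∈ T, P.IsHomogeneous (homogeneousSubmodule σ R))
    (hrel : ∀ P ∈ T, ¬ (HomogeneousIdeal.irrelevant (homogeneousSubmodule σ R)).toIdeal ≤ P)
    (hIP : ∀ P ∈ T, ¬ I ≤ P) :
    ∃ e₀ : ℕ, ∀ e, e₀ ≤ e →
      ∃ F : MvPolynomial σ R, F.IsHomogeneous e ∧ F ∈ I ∧ ∀ P ∈ T, F ∉ P := by
  classical
  induction hT : T.card generalizing T with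
  | zero =>
    rw [Finset.card_eq_zero] at hT
    subst hT
    exact ⟨0, fun e _ => ⟨0, isHomogeneous_zero σ R e, I.zero_mem,
      fun P hP => (Finset.notMem_empty P hP).elim⟩⟩
  | succ n ih =>
    have hne : T.Nonempty := Finset.card_pos.1 (by omega)
    obtain ⟨P, hPT, hPmin⟩ := Finset.exists_minimal hne
    have hcard : (T.erase P).card = n := by rw [Finset.card_erase_of_mem hPT, hT]; rfl
    obtain ⟨e₁, he₁⟩ := ih (T.erase P) (fun Q hQ => hprime Q (Finset.mem_of_mem_erase hQ))
      (fun Q hQ => hhom Q (Finset.mem_of_mem_erase hQ))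
      (fun Q hQ => hrel Q (Finset.mem_of_mem_erase hQ))
      (fun Q hQ => hIP Q (Finset.mem_of_mem_erase hQ)) hcard
    haveI : P.IsPrime := hprime P hPT
    -- a variable `ℓ ∉ P`, a form `b ∈ I ∖ P`
    obtain ⟨t, ht⟩ := MvPolynomial.exists_X_notMem_of_not_irrelevant_le (hrel P hPT)
    obtain ⟨b, db, hb, hbI, hbP⟩ := MvPolynomial.exists_isHomogeneous_mem_notMem hI (hIP P hPT)
    -- homogeneous `a Q ∈ Q ∖ P` for `Q ∈ T ∖ {P}` (possible as `P` is minimal)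
    have hex : ∀ Q ∈ T.erase P, ∃ (a : MvPolynomial σ R) (i : ℕ),
        a.IsHomogeneous i ∧ a ∈ Q ∧ a ∉ P := by
      intro Q hQ
      obtain ⟨hQP, hQT⟩ := Finset.mem_erase.1 hQ
      refine MvPolynomial.exists_isHomogeneous_mem_notMem (hhom Q hQT) fun hle => hQP ?_
      exact le_antisymm hle (hPmin hQT hle)
    choose! a deg ha haQ haP using hex
    -- `y = ℓ · b · ∏ a Q`, homogeneous of degree `δ`, in `I`, in every `Q ≠ P`, not in `P`
    set y : MvPolynomial σ R := X t * b * ∏ Q ∈ T.erase P, a Q with hy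
    set δ : ℕ := 1 + db + ∑ Q ∈ T.erase P, deg Q with hδ
    have hyhom : y.IsHomogeneous δ :=
      ((isHomogeneous_X R t).mul hb).mul
        (IsHomogeneous.prod (T.erase P) a deg fun Q hQ => ha Q hQ)
    have hyI : y ∈ I := by
      rw [hy]
      exact Ideal.mul_mem_right _ _ (Ideal.mul_mem_left _ _ hbI)
    have hyQ : ∀ Q ∈ T.erase P, y ∈ Q := fun Q hQ => by
      obtain ⟨c, hc⟩ := Finset.dvd_prod_of_mem a hQ
      rw [hy, hc]
      exact Ideal.mul_mem_left _ _ (Ideal.mul_mem_right _ _ (haQ Q hQ))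
    have hyP : y ∉ P := by
      intro hyP'
      rcases (hprime P hPT).mem_or_mem hyP' with h | h
      · rcases (hprime P hPT).mem_or_mem h with h' | h'
        · exact ht h'
        · exact hbP h'
      · obtain ⟨Q, hQ, hQP⟩ := Ideal.IsPrime.prod_mem_iff.1 h
        exact haP Q hQ hQP
    -- conclusion: for `e ≥ max e₁ δ`
    refine ⟨max e₁ δ, fun e he => ?_⟩
    obtain ⟨F', hF', hF'I, hF'T⟩ := he₁ e ((le_max_left _ _).trans he)
    by_cases hFP : F' ∈ P
    · refine ⟨F' + X t ^ (e - δ) * y, ?_, I.add_mem hF'I (Ideal.mul_mem_left _ _ hyI), ?_⟩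
      · have h2 : (X t ^ (e - δ) * y).IsHomogeneous e := by
          have := ((isHomogeneous_X R t).pow (e - δ)).mul hyhom
          rwa [one_mul, Nat.sub_add_cancel ((le_max_right _ _).trans he)] at this
        exact hF'.add h2
      · intro Q hQ
        by_cases hQP : Q = P
        · subst hQP
          intro hmem
          have : X t ^ (e - δ) * y ∈ Q := by
            have := Q.sub_mem hmem hFP
            rwa [add_sub_cancel_left] at this
          rcases (hprime Q hPT).mem_or_mem this with h | h
          · exact ht ((hprime Q hPT).mem_of_pow_mem _ h)
          · exact hyP h
        · have hQ' : Q ∈ T.erase P := Finset.mem_erase.2 ⟨hQP, hQ⟩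
          intro hmem
          haveI : Q.IsPrime := hprime Q hQ
          have : F' ∈ Q := by
            have := Q.sub_mem hmem (Ideal.mul_mem_left _ (X t ^ (e - δ)) (hyQ Q hQ'))
            rwa [add_sub_cancel_right] at this
          exact hF'T Q hQ' this
    · refine ⟨F', hF', hF'I, fun Q hQ => ?_⟩
      by_cases hQP : Q = P
      · subst hQP; exact hFP
      · exact hF'T Q (Finset.mem_erase.2 ⟨hQP, hQ⟩)

end Literature.RingTheory.GradedAlgebra

end
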